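import Mathlib
import HarnessLib
import HarnessLib.Audit
import Summits.CriticalPhenomena.PercolationContinuityZ3.Theorems.PercNearOneGluingNoHeavyLowerTailHexMSMatchCoStar
import Summits.CriticalPhenomena.PercolationContinuityZ3.Theorems.PercNearOneGluingNoHeavyLowerTailHexMSMatchMS2Instance

/-!
# (Π2″) for dead-like blocks from the co-star injection (hp-7 gen 76)

Support file for crux `stmt-CriticalPhenomena-4575` (route `PercNearOneGluingNoHeavy`), hull-port seat `prim-hp-7` (generation 76);
`--supports stmt-CriticalPhenomena-4575`.  No `sorry`.  Memo: `run/shared/lean/prim/prim-hp-7/FROM-prim-hp-7-g76-ORDER-CERTIFICATES.md` §9.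

First consumer of the instance-level bridge `GeneratedDonors.two_mul_card_le_card_clU_scTerms_of_ms2At` (`…HexMSMatchMS2Instance`): the explicit
co-star (MS2) theorem `CoStar.ms2_of_coStar` (`…HexMSMatchCoStar`) gives (Π2″) `2 (#P + #Q + #W) ≤ #clU U (scTerms P Q W)` for dead-like blocks
`P ⊔ Q` with complement-free pure blocker representatives `W` whenever some member `p` separates `P ∪ Q` by traces (`g ↦ g \ p` injective), no
blocker is a reverse cross difference, and the designated traces at `p` have nonempty, pairwise distinct, undesignated corners `g ∩ p`
(numerically 72–85 % of the dead-like depth-one configurations, memo §9 (U)); and `card_le_card_farNbhd_of_coStar`, the same pushed through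
`GeneratedDonors.card_le_card_farNbhd_of_ms2At` to the (MATCH*) Hall inequality `#𝒟 ≤ #(farNbhd 𝒟 x (dead U 𝒟 x))` of a depth-one saturated
two-class antipodal instance.
-/

namespace Summit.CriticalPhenomena.PercolationContinuityZ3.Theorems

namespace GeneratedDonors

open Finset FinsetFamily

variable {α : Type*} [DecidableEq α] {U : Finset α}

/-- **(Π2″) for dead-like blocks by the co-star injection** (hp-7 gen 76): the hypotheses of
`two_mul_card_le_card_clU_scTerms_of_ms2` (purity `C2` included) plus: no blocker is a reverse cross difference, a member `p` separating
`P ∪ Q` by traces, and the corner conditions of `CoStar.ms2_of_coStar` for the designated differences derived from `W`. -/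
theorem two_mul_card_le_card_clU_scTerms_of_coStar (P Q W : Finset (Finset α))
    (hU : ∀ a ∈ P ∪ Q, a ⊆ U) (hPQ : Disjoint P Q)
    (hint : ∀ a ∈ P ∪ Q, ∀ b ∈ P ∪ Q, (a ∩ b).Nonempty) (hcov : ∀ a ∈ P ∪ Q, ∀ b ∈ P ∪ Q, a ∪ b ≠ U)
    (hrep : W ⊆ scReps U P Q) (hWco : ∀ a ∈ W, ∀ b ∈ W, a ≠ U \ b)
    (hC2 : ∀ w ∈ W, w ∉ clU U ((P \\ P) ∪ (Q \\ Q)))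
    (hrev₅ : ∀ w ∈ W, w ∉ Q \\ P) (hrev₂ : ∀ d ∈ Q \\ P, U \ d ∈ W → d ∉ P \\ Q)
    (p : Finset α) (hp : p ∈ P ∪ Q) (hinj : Set.InjOn (fun g => g \ p) ↑(P ∪ Q))
    (hne : ∀ g ∈ P ∪ Q, (g \ p ∈ W ∨ (g \ p ∈ Q \\ P ∧ U \ (g \ p) ∈ W)) → (g ∩ p).Nonempty)
    (hcor : ∀ g ∈ P ∪ Q, ∀ g' ∈ P ∪ Q, (g \ p ∈ W ∨ (g \ p ∈ Q \\ P ∧ U \ (g \ p) ∈ W)) →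
      (g' \ p ∈ W ∨ (g' \ p ∈ Q \\ P ∧ U \ (g' \ p) ∈ W)) → g ∩ p = g' ∩ p → g = g')
    (hcid : ∀ g ∈ P ∪ Q, (g \ p ∈ W ∨ (g \ p ∈ Q \\ P ∧ U \ (g \ p) ∈ W)) →
      g ∩ p ∉ W ∧ ¬ (g ∩ p ∈ Q \\ P ∧ U \ (g ∩ p) ∈ W)) :
    2 * (#P + #Q + #W) ≤ #(clU U (scTerms P Q W)) := by
  classical
  set D₅ : Finset (Finset α) := (P \\ Q).filter fun d => d ∈ W with hD₅def
  set D₂ : Finset (Finset α) := (Q \\ P).filter fun d => U \ d ∈ W with hD₂def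
  have hD₅ : D₅ ⊆ P \\ Q := filter_subset _ _
  have hD₂ : D₂ ⊆ Q \\ P := filter_subset _ _
  have hpure : ∀ d ∈ D₅ ∪ D₂, d ∉ (P \\ P) ∪ (Q \\ Q) := by
    intro d hd hbad
    rcases mem_union.mp hd with hd | hd
    · exact hC2 d (mem_filter.mp hd).2 (mem_clU.mpr (Or.inl hbad))
    · exact hC2 _ (mem_filter.mp hd).2 (mem_clU.mpr (Or.inr ⟨d, hbad, rfl⟩))
  -- membership in `D₅ ∪ D₂` unfolded
  have hmemD : ∀ {t : Finset α}, t ∈ D₅ ∪ D₂ → t ∈ W ∨ (t ∈ Q \\ P ∧ U \ t ∈ W) := by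
    intro t ht
    rcases mem_union.mp ht with ht | ht
    · exact Or.inl (mem_filter.mp ht).2
    · exact Or.inr ⟨(mem_filter.mp ht).1, (mem_filter.mp ht).2⟩
  refine two_mul_card_le_card_clU_scTerms_of_ms2At P Q W hU hPQ hint hcov hrep hWco ?_
  refine CoStar.ms2_of_coStar P Q D₅ D₂ hD₅ hD₂ hpure ?_ ?_ p hp hinj ?_ ?_ ?_
  · intro d hd; exact hrev₅ d (mem_filter.mp hd).2
  · intro d hd; exact hrev₂ d (mem_filter.mp hd).1 (mem_filter.mp hd).2
  · intro g hg hgd; exact hne g hg (hmemD hgd)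
  · intro g hg g' hg' hgd hgd' h; exact hcor g hg g' hg' (hmemD hgd) (hmemD hgd') h
  · intro g hg hgd hmem
    obtain ⟨h1, h2⟩ := hcid g hg (hmemD hgd)
    rcases mem_union.mp hmem with hm | hm
    · exact h1 (mem_filter.mp hm).2
    · exact h2 ⟨(mem_filter.mp hm).1, (mem_filter.mp hm).2⟩


section DepthOne

variable {𝒟 : Finset (Finset α)} {x : Finset α → ZMod 6}

/-- **(MATCH*) for a depth-one saturated two-class instance by the co-star injection** (hp-7 gen 76): as `card_le_card_farNbhd_of_ms2At`,
with the instance inequality supplied by `CoStar.ms2_of_coStar` — hypotheses: no alive blocker of label `i+5` is a reverse cross difference of the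
two dead classes, a dead member `p` of label `i` or `i+1` separates the two dead classes by traces, and the designated traces at `p` have nonempty,
pairwise distinct, undesignated corners. -/
theorem card_le_card_farNbhd_of_coStar (hU : ∀ a ∈ 𝒟, a ⊆ U) (hco : ∀ a ∈ 𝒟, U \ a ∈ 𝒟)
    (hanti : ∀ a ∈ 𝒟, x (U \ a) = x a + 3) (i : ZMod 6)
    (hlab : ∀ a ∈ dead U 𝒟 x, x a = i ∨ x a = i + 1 ∨ x a = i + 3 ∨ x a = i + 4)
    (hdepth : ∀ d ∈ 𝒟, d ∉ dead U 𝒟 x →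
      (x d = i + 5 ∧ d ∈ scReps U ((dead U 𝒟 x).filter fun a => x a = i) ((dead U 𝒟 x).filter fun a => x a = i + 1)) ∨
      (x d = i + 2 ∧ U \ d ∈ scReps U ((dead U 𝒟 x).filter fun a => x a = i) ((dead U 𝒟 x).filter fun a => x a = i + 1)))
    (hrev₅ : ∀ w ∈ ((𝒟 \ dead U 𝒟 x).filter fun a => x a = i + 5), w ∉ ((dead U 𝒟 x).filter fun a => x a = i + 1) \\ ((dead U 𝒟 x).filter fun a => x a = i))
    (hrev₂ : ∀ d ∈ ((dead U 𝒟 x).filter fun a => x a = i + 1) \\ ((dead U 𝒟 x).filter fun a => x a = i), U \ d ∈ ((𝒟 \ dead U 𝒟 x).filter fun a => x a = i + 5) → d ∉ ((dead U 𝒟 x).filter fun a => x a = i) \\ ((dead U 𝒟 x).filter fun a => x a = i + 1))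
    (p : Finset α) (hp : p ∈ (((dead U 𝒟 x).filter fun a => x a = i) ∪ ((dead U 𝒟 x).filter fun a => x a = i + 1))) (hinj : Set.InjOn (fun g => g \ p) ↑(((dead U 𝒟 x).filter fun a => x a = i) ∪ ((dead U 𝒟 x).filter fun a => x a = i + 1)))
    (hne : ∀ g ∈ (((dead U 𝒟 x).filter fun a => x a = i) ∪ ((dead U 𝒟 x).filter fun a => x a = i + 1)), (g \ p ∈ ((𝒟 \ dead U 𝒟 x).filter fun a => x a = i + 5) ∨ (g \ p ∈ ((dead U 𝒟 x).filter fun a => x a = i + 1) \\ ((dead U 𝒟 x).filter fun a => x a = i) ∧ U \ (g \ p) ∈ ((𝒟 \ dead U 𝒟 x).filter fun a => x a = i + 5))) → (g ∩ p).Nonempty)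
    (hcor : ∀ g ∈ (((dead U 𝒟 x).filter fun a => x a = i) ∪ ((dead U 𝒟 x).filter fun a => x a = i + 1)), ∀ g' ∈ (((dead U 𝒟 x).filter fun a => x a = i) ∪ ((dead U 𝒟 x).filter fun a => x a = i + 1)), (g \ p ∈ ((𝒟 \ dead U 𝒟 x).filter fun a => x a = i + 5) ∨ (g \ p ∈ ((dead U 𝒟 x).filter fun a => x a = i + 1) \\ ((dead U 𝒟 x).filter fun a => x a = i) ∧ U \ (g \ p) ∈ ((𝒟 \ dead U 𝒟 x).filter fun a => x a = i + 5))) →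
      (g' \ p ∈ ((𝒟 \ dead U 𝒟 x).filter fun a => x a = i + 5) ∨ (g' \ p ∈ ((dead U 𝒟 x).filter fun a => x a = i + 1) \\ ((dead U 𝒟 x).filter fun a => x a = i) ∧ U \ (g' \ p) ∈ ((𝒟 \ dead U 𝒟 x).filter fun a => x a = i + 5))) → g ∩ p = g' ∩ p → g = g')
    (hcid : ∀ g ∈ (((dead U 𝒟 x).filter fun a => x a = i) ∪ ((dead U 𝒟 x).filter fun a => x a = i + 1)), (g \ p ∈ ((𝒟 \ dead U 𝒟 x).filter fun a => x a = i + 5) ∨ (g \ p ∈ ((dead U 𝒟 x).filter fun a => x a = i + 1) \\ ((dead U 𝒟 x).filter fun a => x a = i) ∧ U \ (g \ p) ∈ ((𝒟 \ dead U 𝒟 x).filter fun a => x a = i + 5))) →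
      g ∩ p ∉ ((𝒟 \ dead U 𝒟 x).filter fun a => x a = i + 5) ∧ ¬ (g ∩ p ∈ ((dead U 𝒟 x).filter fun a => x a = i + 1) \\ ((dead U 𝒟 x).filter fun a => x a = i) ∧ U \ (g ∩ p) ∈ ((𝒟 \ dead U 𝒟 x).filter fun a => x a = i + 5))) :
    #𝒟 ≤ #(farNbhd 𝒟 x (dead U 𝒟 x)) := by
  classical
  obtain ⟨n01, n30, n31, n40, n41, n85, n50, n51, n20, n21, n25, n53, n54, e33, e43, e23⟩ := label_facts i
  set P : Finset (Finset α) := (dead U 𝒟 x).filter fun a => x a = i with hPdef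
  set Q : Finset (Finset α) := (dead U 𝒟 x).filter fun a => x a = i + 1 with hQdef
  set W : Finset (Finset α) := (𝒟 \ dead U 𝒟 x).filter fun a => x a = i + 5 with hWdef
  have hP : ∀ p ∈ P, p ∈ dead U 𝒟 x ∧ x p = i := fun p hp => by
    have h := mem_filter.mp hp; exact ⟨h.1, h.2⟩
  have hQ : ∀ q ∈ Q, q ∈ dead U 𝒟 x ∧ x q = i + 1 := fun q hq => by
    have h := mem_filter.mp hq; exact ⟨h.1, h.2⟩
  have hW : ∀ w ∈ W, (w ∈ 𝒟 ∧ w ∉ dead U 𝒟 x) ∧ x w = i + 5 := fun w hw => by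
    have h := mem_filter.mp hw; exact ⟨mem_sdiff.mp h.1, h.2⟩
  have hdD : ∀ {a}, a ∈ dead U 𝒟 x → a ∈ 𝒟 := fun ha => (mem_filter.mp ha).1
  have hcc : ∀ {a}, a ⊆ U → U \ (U \ a) = a := fun ha => Finset.sdiff_sdiff_eq_self ha
  -- the hypotheses of the pure inequality for (P, Q, W)
  have h1 : ∀ a ∈ P ∪ Q, a ⊆ U := by
    intro a ha
    rcases mem_union.mp ha with ha | ha
    · exact hU a (hdD (hP a ha).1)
    · exact hU a (hdD (hQ a ha).1)
  have h2 : Disjoint P Q := by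
    rw [Finset.disjoint_left]
    intro a haP haQ
    exact n01 ((hP a haP).2.symm.trans (hQ a haQ).2)
  have hPQlab : ∀ a ∈ P ∪ Q, a ∈ dead U 𝒟 x ∧ (x a = i ∨ x a = i + 1) := by
    intro a ha
    rcases mem_union.mp ha with ha | ha
    · exact ⟨(hP a ha).1, Or.inl (hP a ha).2⟩
    · exact ⟨(hQ a ha).1, Or.inr (hQ a ha).2⟩
  -- dead-like: pairwise intersecting and non-covering (labels i, i+1 are close)
  have hint : ∀ a ∈ P ∪ Q, ∀ b ∈ P ∪ Q, (a ∩ b).Nonempty := fun a ha b hb =>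
    inter_nonempty_of_dead_of_close (hPQlab a ha).1 (hdD (hPQlab b hb).1)
      (close_of_mem_pair (hPQlab a ha).2 (hPQlab b hb).2)
  have hcov : ∀ a ∈ P ∪ Q, ∀ b ∈ P ∪ Q, a ∪ b ≠ U := fun a ha b hb =>
    union_ne_of_dead_of_close hU hco hanti (hPQlab a ha).1 (hdD (hPQlab b hb).1)
      (close_of_mem_pair (hPQlab a ha).2 (hPQlab b hb).2)
  have h4 : W ⊆ scReps U P Q := by
    intro w hw
    obtain ⟨⟨hwD, hwa⟩, hxw⟩ := hW w hw
    rcases hdepth w hwD hwa with ⟨-, h⟩ | ⟨h2', -⟩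
    · exact h
    · exact absurd (hxw.symm.trans h2') n25.symm
  have h5 : ∀ a ∈ W, ∀ b ∈ W, a ≠ U \ b := by
    intro a ha b hb hab
    have hxa := (hW a ha).2
    have hxb : x a = x b + 3 := by rw [hab]; exact hanti b (hW b hb).1.1
    rw [(hW b hb).2] at hxb
    exact n85 (hxb.symm.trans hxa)
  have h6 : ∀ w ∈ W, w ∉ clU U ((P \\ P) ∪ (Q \\ Q)) := by
    intro w hw hmem
    obtain ⟨⟨hwD, -⟩, -⟩ := hW w hw
    have key : ∀ t ∈ (P \\ P) ∪ (Q \\ Q), t ∉ 𝒟 ∧ t ⊆ U := by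
      intro t ht
      rcases mem_union.mp ht with ht | ht
      · obtain ⟨a, ha, b, hb, rfl⟩ := mem_diffs.mp ht
        have hda := hP a ha; have hdb := hP b hb
        refine ⟨(sdiff_notMem_of_dead_of_label_eq hU hco hanti (hdD hda.1) (hdD hdb.1) (mem_filter.mp hda.1).2
          (mem_filter.mp hdb.1).2 (hda.2.trans hdb.2.symm)).2, sdiff_subset.trans (hU a (hdD hda.1))⟩
      · obtain ⟨a, ha, b, hb, rfl⟩ := mem_diffs.mp ht
        have hda := hQ a ha; have hdb := hQ b hb
        refine ⟨(sdiff_notMem_of_dead_of_label_eq hU hco hanti (hdD hda.1) (hdD hdb.1) (mem_filter.mp hda.1).2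
          (mem_filter.mp hdb.1).2 (hda.2.trans hdb.2.symm)).2, sdiff_subset.trans (hU a (hdD hda.1))⟩
    rcases mem_clU.mp hmem with h | ⟨t, ht, rfl⟩
    · exact (key w h).1 hwD
    · have := hco _ hwD
      rw [hcc (key t ht).2] at this
      exact (key t ht).1 this
  -- the pure inequality from (MS2), and the embedding of the terms
  have hineq : 2 * (#P + #Q + #W) ≤ #(clU U (scTerms P Q W)) :=
    two_mul_card_le_card_clU_scTerms_of_coStar P Q W h1 h2 hint hcov h4 h5 h6 hrev₅ hrev₂ p hp hinj hne hcor hcid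
  have hsub : clU U (scTerms P Q W) ⊆ farNbhd 𝒟 x (dead U 𝒟 x) :=
    clU_scTerms_subset_farNbhd hU hco hanti i hP hQ (fun w hw => ⟨(hW w hw).1.1, (hW w hw).2⟩)
  -- counting 𝒟: every member or its complement lies in P ∪ Q ∪ W
  set A : Finset (Finset α) := 𝒟.filter fun d => x d = i ∨ x d = i + 1 ∨ x d = i + 5 with hAdef
  set B : Finset (Finset α) := 𝒟.filter fun d => ¬ (x d = i ∨ x d = i + 1 ∨ x d = i + 5) with hBdef
  have hmemPQW : ∀ d ∈ 𝒟, (x d = i ∨ x d = i + 1 ∨ x d = i + 5) → d ∈ P ∪ Q ∪ W := by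
    intro d hd hx
    simp only [mem_union]
    by_cases hdead : d ∈ dead U 𝒟 x
    · rcases hx with h | h | h
      · exact Or.inl (Or.inl (mem_filter.mpr ⟨hdead, h⟩))
      · exact Or.inl (Or.inr (mem_filter.mpr ⟨hdead, h⟩))
      · exfalso
        rcases hlab d hdead with h' | h' | h' | h'
        · exact n50 (h.symm.trans h')
        · exact n51 (h.symm.trans h')
        · exact n53 (h.symm.trans h')
        · exact n54 (h.symm.trans h')
    · rcases hdepth d hd hdead with ⟨h5', -⟩ | ⟨h2', -⟩
      · exact Or.inr (mem_filter.mpr ⟨mem_sdiff.mpr ⟨hd, hdead⟩, h5'⟩)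
      · exfalso
        rcases hx with h | h | h
        · exact n20 (h2'.symm.trans h)
        · exact n21 (h2'.symm.trans h)
        · exact n25 (h2'.symm.trans h)
  have hA : A ⊆ P ∪ Q ∪ W := fun d hd => hmemPQW d (mem_filter.mp hd).1 (mem_filter.mp hd).2
  have hB : B.image (fun d => U \ d) ⊆ P ∪ Q ∪ W := by
    intro e he
    obtain ⟨d, hd, rfl⟩ := mem_image.mp he
    obtain ⟨hdD', hnot⟩ := mem_filter.mp hd
    refine hmemPQW (U \ d) (hco d hdD') ?_
    rw [hanti d hdD']
    by_cases hdead : d ∈ dead U 𝒟 x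
    · rcases hlab d hdead with h | h | h | h
      · exact absurd (Or.inl h) hnot
      · exact absurd (Or.inr (Or.inl h)) hnot
      · rw [h]; exact Or.inl e33
      · rw [h]; exact Or.inr (Or.inl e43)
    · rcases hdepth d hdD' hdead with ⟨h5', -⟩ | ⟨h2', -⟩
      · exact absurd (Or.inr (Or.inr h5')) hnot
      · rw [h2']; exact Or.inr (Or.inr e23)
  have hinjB : Set.InjOn (fun d : Finset α => U \ d) ↑B := by
    intro d hd e he hde
    have hdU : d ⊆ U := hU d (mem_filter.mp (mem_coe.mp hd)).1
    have heU : e ⊆ U := hU e (mem_filter.mp (mem_coe.mp he)).1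
    have h1' := congrArg (fun t => U \ t) hde
    simp only [hcc hdU, hcc heU] at h1'
    exact h1'
  have hsplit : #A + #B = #𝒟 := card_filter_add_card_filter_not _
  have hcardA : #A ≤ #(P ∪ Q ∪ W) := card_le_card hA
  have hcardB : #B ≤ #(P ∪ Q ∪ W) := by
    rw [← card_image_of_injOn hinjB]; exact card_le_card hB
  have hunion : #(P ∪ Q ∪ W) ≤ #P + #Q + #W :=
    (card_union_le _ _).trans (Nat.add_le_add_right (card_union_le _ _) _)
  have hT := card_le_card hsub
  omega

end DepthOne

end GeneratedDonors

end Summit.CriticalPhenomena.PercolationContinuityZ3.Theorems
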